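import Summits.BirchSwinnertonDyer.BirchSwinnertonDyer.Theses.GenusKolyvaginAtTwo
import Summits.BirchSwinnertonDyer.BirchSwinnertonDyer.Theorems.GenusKolyvaginAtTwoMinimalTwinBSDTwoAllDepthCells
import Summits.BirchSwinnertonDyer.BirchSwinnertonDyer.Theorems.GenusKolyvaginAtTwoKolyvaginExclusionsOfHeegner
import Summits.BirchSwinnertonDyer.BirchSwinnertonDyer.Theorems.GenusKolyvaginAtTwoMinimalTwinBSDTwoUniformCell
import HarnessLib

/-!
# Route `GenusKolyvaginAtTwo`, crux U₂ `MinimalTwinBSDTwo` (stmt-BirchSwinnertonDyer-22985), LINE 23 «twin_swap»: THE JETCHEV SPLIT IS EXACT PER FRAME —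
# given item 27467 at a one-bit frame of the slice 𝒮, «NDIV⁻ at the frame» ⟺ `BSD₂(W)` (modulo `BSD₂(Wd)` and PRINT)

Seat `bsd-line-gk2-p2` g28 (PROVER seat 2/3, cell `bsd-f1-sign2`; LINE 23 holder), `--supports stmt-BirchSwinnertonDyer-22985` (helper; closes nothing).
Sequel of `…MinimalTwinBSDTwoJetchevSplit` (p790748/p791873).  THEOREMS ONLY (no definition, no named fact, no `sorry`); standard axioms.  **BSD is NOT
proved by this file; U₂, 27467, NDIV⁻, the wall are NOT proved; no item is closed.**

THE POINT (census exactness).  `…JetchevSplit` §2–§3 give the SUFFICIENCY «27467 ∧ NDIV⁻ ⟹ EXP⁻ ⟹ BSD₂(W)» at a door-open `2`-Selmer-trivial frame of a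
`Δ < 0` curve of the slice 𝒮 (`N_W` odd, `ρ_{W,2^∞}` onto, optimal odd-Manin datum, `ord₂ C(W)` carried by one prime).  This file adds NECESSITY at the
same frame: `BSD₂(W) ∧ BSD₂(Wd)` + PRINT ⟹ `2^{ord₂ c + ord₂ C(W)} ∥ P(1)` (the lineage's `OneBit.twoDivExponent_eq_padicValNat_tamagawa_of_bsdp` on the exact
depth, which EXISTS by Mordell–Weil over `K[1]` + Krull, `KolyvaginAtTwo.exists_exactTwoDepth`), hence NDIV⁻.  So PER FRAME, granted item 27467 (Jetchev at 2),
`BSD₂(Wd)` and PRINT: **NDIV⁻ ⟺ BSD₂(W)** — the shifted 2-primitivity of `y_K` is EXACTLY the open content, no over- and no under-claim.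
Nothing here is progress on BSD.

References: [Jetchev2008] Thm. 1.4; [GrossZagier1986] I.(6.3), V.§2 (2.2); [McCallumLMS1991] §5 Lemma 5.1; [Kramer1981] Thm. 1; [Milne1972ArithmeticAV] §1
Thm. 1; [SilvermanAEC2009] Thm. VIII.6.7; [Miller2011LMS] Def. 1.1.
-/

set_option autoImplicit false
set_option linter.dupNamespace false -- `Summit.<P>.<Sub>` repeats `BirchSwinnertonDyer` (D-0017)

noncomputable section

open scoped Classical

open WeierstrassCurve NumberField Literature.NumberTheory.EllipticCurves
  Literature.NumberTheory.EllipticCurves.ModularForms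
  Literature.NumberTheory.EllipticCurves.Rank1Residual
  Literature.NumberTheory.QuadraticFields
  Summit.BirchSwinnertonDyer.Rank1Residual
  Summit.BirchSwinnertonDyer.Rank1Residual.AdditivePotMult
  Summit.BirchSwinnertonDyer.BirchSwinnertonDyer.Rank1Residual
  Summit.BirchSwinnertonDyer.BirchSwinnertonDyer.Theorems
  Summit.BirchSwinnertonDyer.BirchSwinnertonDyer.Theorems.GenusExact.TwinSwap
  Summit.BirchSwinnertonDyer.BirchSwinnertonDyer.Theses.GenusKolyvaginAtTwo

open Summit.BirchSwinnertonDyer.BirchSwinnertonDyer.Theorems.GenusExact.TwinSwap.OneBit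
  (swappedPairDescentAtTwo_tamagawaDepth_of_facts twoDivExponent_eq_padicValNat_tamagawa_of_bsdp)
open Summit.BirchSwinnertonDyer.BirchSwinnertonDyer.Theorems.GenusExact
  (not_isSquare_discr_mul_neg_abs_Δ_of_odd not_isSquare_discr_mul_neg_two_mul_abs_Δ_of_odd)
open Summit.BirchSwinnertonDyer.BirchSwinnertonDyer.Theorems.KolyvaginAtTwo (exists_exactTwoDepth)

namespace Summit.BirchSwinnertonDyer.BirchSwinnertonDyer.Theorems.GenusExact.TwinSwap.JetchevSplitLossless

/-- **NDIV⁻ IS NECESSARY: `BSD₂(W) ∧ BSD₂(Wd)` + PRINT ⟹ `P(1) ∉ 2^{ord₂ c + ord₂ C(W) + 1} W(K[1])`** at a one-bit `2`-Selmer-trivial frame (`W` rank-`1`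
`#Sel₂ = 2`, `Δ_W < 0`; `K` imaginary quadratic, `d_K` odd `≠ −3`, Heegner; `Wd ≅ W^{(d_K)}` globally minimal with `#Sel₂(Wd) = 1` inside the one-bit
budget; any datum with `c ≠ 0`, `P(1)` of infinite order).  The exact depth of `P(1)` exists (Mordell–Weil over the ring class field + Krull) and
the BSD pair pins it at `ord₂ c + ord₂ C(W)` (`OneBit.twoDivExponent_eq_padicValNat_tamagawa_of_bsdp`).  CONDITIONAL on the two `BSD₂` hypotheses and the
named facts; a losslessness statement, not progress on BSD. [cite: GrossZagier1986, V.§2 (2.2)] [cite: SilvermanAEC2009, Thm. VIII.6.7]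
[cite: McCallumLMS1991, §5 Lemma 5.1] [cite: Milne1972ArithmeticAV, §1 Thm. 1] -/
theorem ndiv_of_bsdp_pair_of_facts
    (W : WeierstrassCurve ℚ) [W.IsElliptic] [W.IsGloballyMinimal] [NeZero (W.conductorNorm ℤ)]
    (K : Type) [Field K] [NumberField K]
    (hGZ : gross_zagier (W.conductorNorm ℤ) W K) (hGZK : rank_eq_analyticRank_of_analyticRank_le_one)
    (hmod : hasEntireLFunction_rat) (hMilneC : Milne1972.bsdQuotient_baseChange_quadratic_anyModel)
    (hr : W.analyticRank = 1) (hSel : Nat.card (W.selmerGroup 2) = 2) (hΔ : W.Δ < 0)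
    (hK : IsImaginaryQuadratic K) (hodd : Odd (NumberField.discr K)) (h3 : NumberField.discr K ≠ -3)
    (hH : SatisfiesHeegnerHypothesis (W.conductorNorm ℤ) K)
    (Dt : ModularParametrizationData W (W.conductorNorm ℤ)) (hc0 : Dt.c ≠ 0) (β : ℤ) (ι : K →+* ℂ)
    (d₁ : KolyvaginHeegnerData Dt β ι 1) (hy : ¬ IsOfFinAddOrder d₁.derivedPoint)
    (Wd : WeierstrassCurve ℚ) [Wd.IsElliptic] [Wd.IsGloballyMinimal]
    (hWd : ∃ C : VariableChange ℚ, C • W.quadraticTwist (NumberField.discr K : ℚ) = Wd)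
    (hSel1 : Nat.card (Wd.selmerGroup 2) = 1)
    (hDEF : padicValNat 2 Wd.tamagawaProduct ≤ padicValNat 2 W.tamagawaProduct + 1)
    (hBW : BSDp W 2) (hBd : BSDp Wd 2) :
    ¬ ∃ Q : (W.baseChange (ringClassField K ι 1)).toAffine.Point,
      ((2 ^ (padicValInt 2 Dt.c + padicValNat 2 W.tamagawaProduct + 1) : ℕ) : ℤ) • Q = d₁.derivedPoint := by
  -- `W(K[1])` is finitely generated (Mordell–Weil over the number field `K[1]`)
  haveI := (finiteDimensional_and_isGalois_ringClassField hK ι one_ne_zero).1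
  haveI : NumberField (ringClassField K ι 1) := NumberField.of_module_finite K _
  haveI : (W.baseChange (ringClassField K ι 1)).IsElliptic := by rw [baseChange]; infer_instance
  haveI : Module.Finite ℤ (W.baseChange (ringClassField K ι 1)).toAffine.Point := by
    convert (W.baseChange (ringClassField K ι 1)).module_finite_point_holds
  -- the exact `2`-divisibility depth of `P(1)`, pinned by the BSD pair
  obtain ⟨M₀, hdiv, hndiv⟩ := exists_exactTwoDepth
    (A := (W.baseChange (ringClassField K ι 1)).toAffine.Point) (y := d₁.derivedPoint) (by convert hy)
  have hM₀ := twoDivExponent_eq_padicValNat_tamagawa_of_bsdp W K hGZ hGZK hmod hMilneC hr hSel hΔ hK hodd h3 hH Dt hc0 β ι d₁ hy hdiv hndiv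
    Wd hWd hSel1 hDEF hBW hBd
  rw [← hM₀]
  exact hndiv

/-- ★ **THE SPLIT IS EXACT PER FRAME: granted item 27467, `BSD₂(Wd)` and PRINT, NDIV⁻ ⟺ BSD₂(W).**  Frame: `W/ℚ` globally minimal non-CM with
`r_an = 1`, `#Sel₂(W) = 2`, `Δ_W < 0`, `N_W` odd, `ρ_{W,2^∞}` onto, the `2`-part of `C(W)` carried by one prime `q₀ ∣ N_W`; `K` imaginary quadratic, `d_K`
odd `≠ −3`, Heegner for `N_W`; an optimal datum `Dt` with odd Manin constant and a conductor-`1` datum `d₁` with `P(1)` of infinite order; `Wd` a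
globally minimal `2`-Selmer-trivial twin inside the one-bit budget with `BSD₂(Wd)`.  Then
**«`P(1) ∉ 2^{ord₂ C(W)+1} W(K[1])`» ↔ `BSDp W 2`**: (→) `…JetchevSplit` §2 (DIV from 27467 at `n = 1`) + `OneBit.swappedPairDescentAtTwo_tamagawaDepth_of_facts`;
(←) `ndiv_of_bsdp_pair_of_facts`.  CONDITIONAL on `hJ` (OPEN crux 27467), `BSD₂(Wd)` and the named facts; proves nothing about BSD; closes nothing.
[cite: Jetchev2008, Thm. 1.4] [cite: GrossZagier1986, V.§2 (2.2)] [cite: Kramer1981, Thm. 1] [cite: Milne1972ArithmeticAV, §1 Thm. 1] [cite: Miller2011LMS, Def. 1.1] -/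
theorem ndiv_iff_bsdp_of_tamagawaDivisibilityAtTwo (hJ : TamagawaDivisibilityAtTwo)
    (W : WeierstrassCurve ℚ) [W.IsElliptic] [W.IsGloballyMinimal] [NeZero (W.conductorNorm ℤ)]
    (K : Type) [Field K] [NumberField K]
    (hGZ : ∀ (N : ℕ) [NeZero N] (W : WeierstrassCurve ℚ) (K : Type) [Field K] [NumberField K], gross_zagier N W K)
    (hGZK : rank_eq_analyticRank_of_analyticRank_le_one)
    (hmod : hasEntireLFunction_rat) (hMilneC : Milne1972.bsdQuotient_baseChange_quadratic_anyModel)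
    (hcm : ¬ W.HasCM) (hr : W.analyticRank = 1) (hSel : Nat.card (W.selmerGroup 2) = 2) (hΔ : W.Δ < 0)
    (hN : ¬ 2 ∣ W.conductorNorm ℤ) (hρ : ∀ n : ℕ, 0 < n → W.HasSurjectiveModNGaloisRep ((2 : ℤ) ^ n))
    (hq₀ : ∃ (q₀ : ℕ) (_ : Fact q₀.Prime), (q₀ : ℤ) ∣ W.conductorNorm ℤ ∧
      padicValNat 2 ((W.baseChange ℚ_[q₀]).localTamagawaNumber ℤ_[q₀]) = padicValNat 2 W.tamagawaProduct)
    (hK : IsImaginaryQuadratic K) (hodd : Odd (NumberField.discr K)) (h3 : NumberField.discr K ≠ -3)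
    (hH : SatisfiesHeegnerHypothesis (W.conductorNorm ℤ) K)
    (Dt : ModularParametrizationData W (W.conductorNorm ℤ))
    (hlat : ∀ z ∈ Dt.L.lattice, ∃ w ∈ periodLattice Dt.f, z = (Dt.c : ℂ) * w) (hc : Odd Dt.c)
    (β : ℤ) (ι : K →+* ℂ) (d₁ : KolyvaginHeegnerData Dt β ι 1) (hy : ¬ IsOfFinAddOrder d₁.derivedPoint)
    (Wd : WeierstrassCurve ℚ) [Wd.IsElliptic] [Wd.IsGloballyMinimal]
    (hWd : ∃ C : VariableChange ℚ, C • W.quadraticTwist (NumberField.discr K : ℚ) = Wd)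
    (hSel1 : Nat.card (Wd.selmerGroup 2) = 1)
    (hDEF : padicValNat 2 Wd.tamagawaProduct ≤ padicValNat 2 W.tamagawaProduct + 1) (hBd : BSDp Wd 2) :
    (¬ ∃ Q : (W.baseChange (ringClassField K ι 1)).toAffine.Point,
        ((2 ^ (padicValNat 2 W.tamagawaProduct + 1) : ℕ) : ℤ) • Q = d₁.derivedPoint) ↔ BSDp W 2 := by
  have hc0 : Dt.c ≠ 0 := fun h ↦ Dt.cast_c_ne_zero (by rw [h, Int.cast_zero])
  have hc2 : padicValInt 2 Dt.c = 0 :=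
    padicValInt.eq_zero_of_not_dvd fun h ↦ (Int.not_even_iff_odd.mpr hc) (even_iff_two_dvd.mpr (by exact_mod_cast h))
  have h4 : NumberField.discr K ≠ -4 := fun h ↦ by
    rw [h] at hodd
    exact (Int.not_even_iff_odd.mpr hodd) ⟨-2, by norm_num⟩
  constructor
  · intro hndiv
    -- DIV from item 27467 at `n = 1` (the field exclusions are automatic at odd `d_K`), then the one-bit swapped descent
    obtain ⟨q₀, hq₀F, hq₀N, hconc⟩ := hq₀
    have hdiv : ∃ Q : (W.baseChange (ringClassField K ι 1)).toAffine.Point,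
        ((2 ^ (padicValInt 2 Dt.c + padicValNat 2 W.tamagawaProduct) : ℕ) : ℤ) • Q = d₁.derivedPoint := by
      rw [hc2, zero_add, ← hconc]
      exact hJ W hcm hΔ K hK h3 h4 hH hN (not_isSquare_discr_mul_neg_abs_Δ_of_odd W hK hodd hH)
        (not_isSquare_discr_mul_neg_two_mul_abs_Δ_of_odd W hK hodd hH) hρ ⟨Dt, hlat⟩ Dt β ι d₁ hy q₀ hq₀N _ le_rfl 1 d₁ squarefree_one
        (fun ℓ hℓ ↦ absurd hℓ (by rw [Nat.primeFactors_one]; exact Finset.notMem_empty ℓ))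
    have hndiv' : ¬ ∃ Q : (W.baseChange (ringClassField K ι 1)).toAffine.Point,
        ((2 ^ (padicValInt 2 Dt.c + padicValNat 2 W.tamagawaProduct + 1) : ℕ) : ℤ) • Q = d₁.derivedPoint := by
      rw [hc2, zero_add]; exact hndiv
    exact swappedPairDescentAtTwo_tamagawaDepth_of_facts hGZ hGZK hmod hMilneC W hr hSel hΔ K hK hodd h3 hH Dt hc0 β ι d₁ hy hdiv hndiv'
      Wd hWd hSel1 hDEF hBd
  · intro hBW
    have h := ndiv_of_bsdp_pair_of_facts W K (hGZ _ W K) hGZK hmod hMilneC hr hSel hΔ hK hodd h3 hH Dt hc0 β ι d₁ hy Wd hWd hSel1 hDEF hBW hBd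
    rw [hc2, zero_add] at h
    exact h

/-! ## §2 (appended, same seat) The DIV half is BSD-necessary too: item 27467's `n = 1` conclusion from the BSD pair -/

/-- **DIV IS NECESSARY: `BSD₂(W) ∧ BSD₂(Wd)` + PRINT ⟹ `2^s ∣ P(1)` for every prime `q` and every `s ≤ ord₂ c_q(W)`** (= the `n = 1` conclusion of
item 27467 `TamagawaDivisibilityAtTwo` at this frame), at a one-bit `2`-Selmer-trivial frame as in `ndiv_of_bsdp_pair_of_facts`.  The BSD pair pins the
exact depth of `P(1)` at `ord₂ c + ord₂ C(W) ≥ ord₂ C(W) ≥ ord₂ c_q ≥ s` (`c_q ∣ C(W)`: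
`BoxerDiao2010.localTamagawaNumber_padic_dvd_tamagawaProduct`).  With §1: at such a frame, granted PRINT and `BSD₂(Wd)`,
**BSD₂(W) ⟺ (27467|_{n=1} ∧ NDIV⁻)** — Gross–Zagier V (2.3)'s prediction `c·∏c_q ∣ [E(K):ℤy_K]` read `2`-adically for the rank-one member.
CONDITIONAL on the two `BSD₂` hypotheses and the named facts; a losslessness statement, not progress on BSD.
[cite: GrossZagier1986, V.§2 (2.2)–(2.3)] [cite: Jetchev2008, Thm. 1.4, Cor. 1.5] [cite: SilvermanAEC2009, Cor. VII.6.2] -/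
theorem twoPow_dvd_derivedPoint_one_of_bsdp_pair_of_facts
    (W : WeierstrassCurve ℚ) [W.IsElliptic] [W.IsGloballyMinimal] [NeZero (W.conductorNorm ℤ)]
    (K : Type) [Field K] [NumberField K]
    (hGZ : gross_zagier (W.conductorNorm ℤ) W K) (hGZK : rank_eq_analyticRank_of_analyticRank_le_one)
    (hmod : hasEntireLFunction_rat) (hMilneC : Milne1972.bsdQuotient_baseChange_quadratic_anyModel)
    (hr : W.analyticRank = 1) (hSel : Nat.card (W.selmerGroup 2) = 2) (hΔ : W.Δ < 0)
    (hK : IsImaginaryQuadratic K) (hodd : Odd (NumberField.discr K)) (h3 : NumberField.discr K ≠ -3)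
    (hH : SatisfiesHeegnerHypothesis (W.conductorNorm ℤ) K)
    (Dt : ModularParametrizationData W (W.conductorNorm ℤ)) (hc0 : Dt.c ≠ 0) (β : ℤ) (ι : K →+* ℂ)
    (d₁ : KolyvaginHeegnerData Dt β ι 1) (hy : ¬ IsOfFinAddOrder d₁.derivedPoint)
    (Wd : WeierstrassCurve ℚ) [Wd.IsElliptic] [Wd.IsGloballyMinimal]
    (hWd : ∃ C : VariableChange ℚ, C • W.quadraticTwist (NumberField.discr K : ℚ) = Wd)
    (hSel1 : Nat.card (Wd.selmerGroup 2) = 1)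
    (hDEF : padicValNat 2 Wd.tamagawaProduct ≤ padicValNat 2 W.tamagawaProduct + 1)
    (hBW : BSDp W 2) (hBd : BSDp Wd 2)
    (q : ℕ) [Fact q.Prime] (s : ℕ) (hs : s ≤ padicValNat 2 ((W.baseChange ℚ_[q]).localTamagawaNumber ℤ_[q])) :
    ∃ Q : (W.baseChange (ringClassField K ι 1)).toAffine.Point, ((2 ^ s : ℕ) : ℤ) • Q = d₁.derivedPoint := by
  haveI : Fact (Nat.Prime 2) := ⟨Nat.prime_two⟩
  -- `W(K[1])` is finitely generated (Mordell–Weil over the number field `K[1]`)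
  haveI := (finiteDimensional_and_isGalois_ringClassField hK ι one_ne_zero).1
  haveI : NumberField (ringClassField K ι 1) := NumberField.of_module_finite K _
  haveI : (W.baseChange (ringClassField K ι 1)).IsElliptic := by rw [baseChange]; infer_instance
  haveI : Module.Finite ℤ (W.baseChange (ringClassField K ι 1)).toAffine.Point := by
    convert (W.baseChange (ringClassField K ι 1)).module_finite_point_holds
  -- the exact depth of `P(1)`, pinned by the BSD pair at `ord₂ c + ord₂ C(W)`
  obtain ⟨M₀, hdiv, hndiv⟩ := exists_exactTwoDepth
    (A := (W.baseChange (ringClassField K ι 1)).toAffine.Point) (y := d₁.derivedPoint) (by convert hy)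
  have hM₀ := twoDivExponent_eq_padicValNat_tamagawa_of_bsdp W K hGZ hGZK hmod hMilneC hr hSel hΔ hK hodd h3 hH Dt hc0 β ι d₁ hy hdiv hndiv
    Wd hWd hSel1 hDEF hBW hBd
  -- `s ≤ ord₂ c_q ≤ ord₂ C(W) ≤ ord₂ c + ord₂ C(W) = M₀`
  have hcq : padicValNat 2 ((W.baseChange ℚ_[q]).localTamagawaNumber ℤ_[q]) ≤ padicValNat 2 W.tamagawaProduct :=
    (padicValNat_dvd_iff_le (W.tamagawaProduct_pos_holds).ne').mp
      (pow_padicValNat_dvd.trans (BoxerDiao2010.localTamagawaNumber_padic_dvd_tamagawaProduct W q))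
  have hsM : s ≤ M₀ := by rw [hM₀]; omega
  obtain ⟨Q, hQ⟩ := hdiv
  refine ⟨((2 ^ (M₀ - s) : ℕ) : ℤ) • Q, ?_⟩
  rw [smul_smul, ← Nat.cast_mul, ← pow_add, Nat.add_sub_cancel' hsM, hQ]

end Summit.BirchSwinnertonDyer.BirchSwinnertonDyer.Theorems.GenusExact.TwinSwap.JetchevSplitLossless

end
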